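import Literature.NumberTheory.Automorphic.CDTTheorem722
import Literature.NumberTheory.Automorphic.KisinTaylorWilesHypothesisFive
import Literature.NumberTheory.EllipticCurves.Kato2004.TateModuleFilAtInertia
import Literature.NumberTheory.EllipticCurves.ManinConstantQuadraticTwistClassCertificate
import Literature.NumberTheory.EllipticCurves.GreenbergSelmerOrdinaryFiltrationProofs
import HarnessLib

/-!
# Stub-ideation k1 (GEN 5, 2026-08-31) for `stub_liftFive` (crux stmt-ABC-11340, line `Sketch`)

Backs `STUB-IDEAS-stub_liftFive-1.md` (HOME FAMILY 1 — RECOGNISE & IMPORT), gen 5.  Elaboration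
sanity only: every `sorry` is a HELPER LEMMA offered to the stub prover; every sorry-free theorem is
glue / calibration the prover can copy.  The gen-4 companion `STUB_IDEAS_stub_liftFive_1.lean`
(Plans A/B: Rubin-1997-Thm-B seat, FLS road, B1 proved) stays valid and is NOT repeated here.

GEN-5 CONTENT (Plan W, "the ordinary engine on tree carriers"): on the only instance the skeleton
consumes (Frey curve, case B ⇒ `5 ∣ abc`, k3 gen 2) the curve is MULTIPLICATIVE at `5`, so
`ρ_{E,5}|_{Γ_{ℚ₅}}` is ORDINARY and `5`-distinguished and the printed engine is Wiles 1995, Thm. 0.2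
case (I)/(Se) (Selmer deformations) + Taylor–Wiles + Diamond 1996 — NOT the flat / potentially
Barsotti–Tate machinery of CDT.  This file (1) splits the stub by the reduction type at `5`
(`¬ 25 ∣ N ⇒` good or multiplicative, tree theorem) with the glue PROVED, (2) types the local
inputs of the ordinary engine on the tree's EXISTING carriers — `Kato2004.tateModuleFilAt`
(`F⁺_v T_pE`), `GaloisRep.cyclotomicCharacter`, `absInertia`, `modPCyclotomicCharacterZMod`,
the frame shape consumed by `NearlyOrdinaryDatum.frame_spec` / `OrdinaryFiltration` — as one-cycle
helpers W1, W1b, W1c, W4a, and (3) records that Kisin's `p = 5` Taylor–Wiles hypothesis is already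
a THEOREM of the tree for every elliptic curve over `ℚ` (W3, proved by citation).
-/

set_option autoImplicit false
set_option linter.dupNamespace false

noncomputable section

open scoped NumberField MatrixGroups
open NumberField IsDedekindDomain Field WeierstrassCurve Rat.HeightOneSpectrum
  IsDedekindDomain.HeightOneSpectrum
  Literature.NumberTheory
  Literature.NumberTheory.GaloisRepresentations Literature.NumberTheory.Automorphic
  Literature.NumberTheory.Automorphic.BCDT Literature.NumberTheory.EllipticCurves
  Literature.NumberTheory.EllipticCurves.ModularForms
  Literature.NumberTheory.EllipticCurves.Kato2004
  Literature.NumberTheory.EllipticCurves.Kato2004.EulerSystemValues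

namespace Summit.ABC.ABC.Cruxes.FreyModularity.StubIdeasLiftFive1g5

/-! ## §0 The stub and its split by the reduction type at `5` -/

/-- VERBATIM statement of the registered stub `stub_liftFive`. -/
def LiftFive : Prop :=
  ∀ (W : WeierstrassCurve ℚ) [W.IsElliptic] (ρ : ModPGaloisRep ℚ (ZMod 5) 2),
    W.IsTorsionGaloisRep 5 ρ → ρ.IsAbsIrreducibleOverSqrt 5 → ¬ 25 ∣ W.conductorNorm ℤ →
    ρ.IsModular → W.IsModularGaloisRepTate 5

/-- **The MULTIPLICATIVE-at-`5` case** (the only one the skeleton consumes: k3's G-extreme, case B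
forces `5 ∣ abc`): Wiles 1995 Thm. 0.2 case (I) (`ρ̄₀` ordinary) + Diamond 1996 Thm. 5.3, for
`ρ_{E,5}` of a curve with multiplicative reduction at `5` — `ρ_{E,5}|_{Γ_{ℚ₅}} ≅ (εδ ∗; 0 δ)`, `δ`
unramified quadratic, i.e. a SELMER deformation (Se) of `ρ̄₀ = ρ̄_{E,5}`. -/
def MultLiftFive : Prop :=
  ∀ (W : WeierstrassCurve ℚ) [W.IsElliptic] (ρ : ModPGaloisRep ℚ (ZMod 5) 2),
    W.IsTorsionGaloisRep 5 ρ → ρ.IsAbsIrreducibleOverSqrt 5 →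
    W.HasMultiplicativeReductionAtPrime 5 → ρ.IsModular → W.IsModularGaloisRepTate 5

/-- **The GOOD-at-`5` case** (empty on the consumed Frey family; kept so that the split is the
stub VERBATIM): Wiles Thm. 0.2 case (I) ordinary-good or case (II) flat (supersingular), again
under Diamond 1996 away from `5`. -/
def GoodLiftFive : Prop :=
  ∀ (W : WeierstrassCurve ℚ) [W.IsElliptic] (ρ : ModPGaloisRep ℚ (ZMod 5) 2),
    W.IsTorsionGaloisRep 5 ρ → ρ.IsAbsIrreducibleOverSqrt 5 →
    W.HasGoodReductionAtPrime 5 → ρ.IsModular → W.IsModularGaloisRepTate 5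

/-- **W2 (PROVED glue): the stub is exactly the conjunction of its two local regimes at `5`.**
`¬ 25 ∣ N_E ⇒ E` has good or multiplicative reduction at `5` is the tree theorem
`hasGoodReductionAtPrime_or_hasMultiplicativeReductionAtPrime_of_not_sq_dvd_conductorNorm`
(Silverman ATAEC IV.10.2(c)). -/
theorem liftFive_of_good_of_mult (hg : GoodLiftFive) (hm : MultLiftFive) : LiftFive := by
  intro W _ ρ hρ hirr h25 hmod
  have h5 : ¬ 5 ^ 2 ∣ W.conductorNorm ℤ := by norm_num; exact h25
  rcases hasGoodReductionAtPrime_or_hasMultiplicativeReductionAtPrime_of_not_sq_dvd_conductorNorm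
      (V := W) (q := 5) h5 with hgood | hmult
  · exact hg W ρ hρ hirr hgood hmod
  · exact hm W ρ hρ hirr hmult hmod

/-- Calibration (PROVED): the multiplicative case is implied by the accepted named fact
`CDT_theorem_7_2_2` (so `MultLiftFive` is no stronger, inside the tree, than existing debt). -/
theorem multLiftFive_of_CDT (h : CDT_theorem_7_2_2) : MultLiftFive :=
  fun W _ ρ hρ hirr _ hmod ↦ lift_of_CDT_theorem_7_2_2 h W ρ hρ hirr hmod

/-! ## §1 Local inputs of the ORDINARY engine at a multiplicative `v ∣ p`, on tree carriers

W1 is the MULTIPLICATIVE twin of the tree's PROVED named fact `Kato2004.tateModuleFilAt_inertia_ordinary`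
(`tateModuleFilAt_inertia_ordinary_holds`, good ordinary case): same carriers, `IsOrdinaryAt W p`
replaced by multiplicative reduction at `v`.  Proof route (one prover cycle, M): the PROVED twisted
Tate uniformisation with its reduction clause `E₁(K̄_v) = Ψ(1 + 𝔪)`
(`TateCurve.exists_twistedTateUniformisation_localKernelOfReduction_iff`,
`mem_localKernelOfReduction_iff_exists_zpow_of_tate`) gives `Fil_v E[p^k] = Ψ(μ_{p^k})` in residue
characteristic `p`; `σ ∈ Γ_{K_v}` moves `u = ζ^a q^{b/p^k}` by a `p`-power root of unity (so (1) holds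
even on the whole decomposition group, up to the unramified twist `χ`), and acts on `μ_{p^∞}` by
`χ_cyc · χ` with `χ` unramified (`TateCurve/MultiplicativeTwistUnramifiedProofs`). -/

/-- **W1 (helper, M) — inertia at a MULTIPLICATIVE `v ∣ p` acts trivially on `T_pE ⧸ F⁺_v` and by
`χ_cyc` on `F⁺_v T_pE`.**  Verbatim the clauses of `tateModuleFilAt_inertia_ordinary` with the
hypothesis `IsOrdinaryAt W p` (good ordinary) replaced by `W.HasMultiplicativeReductionAt v`.
[Silverman ATAEC V.5.3, Ex. 5.13(a): `0 → T_ℓ(μ) → T_ℓ(E_q) → ℤ_ℓ → 0`; Greenberg LNM 1716 §2] -/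
theorem W1_tateModuleFilAt_inertia_multiplicative (W : WeierstrassCurve ℚ) [W.IsElliptic]
    (p : ℕ) [Fact p.Prime] [ContinuousSMul ℤ_[p] (W.tateModule p)]
    (v : HeightOneSpectrum (𝓞 ℚ)) (hv : ((p : ℕ) : 𝓞 ℚ) ∈ v.asIdeal)
    (hmult : W.HasMultiplicativeReductionAt v) :
    ∀ σ ∈ absInertia (v.adicCompletion ℚ),
      (∀ a : W.tateModule p, (tateRep W p).toLocal v σ a - a ∈ tateModuleFilAt W p v) ∧
      (∀ a ∈ tateModuleFilAt W p v, (tateRep W p).toLocal v σ a =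
        ((GaloisRep.cyclotomicCharacter (v.adicCompletion ℚ) p σ : ℤ_[p]ˣ) : ℤ_[p]) • a) := by
  sorry

/-- **W1b (helper, M−) — at a multiplicative `v ∣ p`, `F⁺_v T_pE` is a direct summand of rank one**
(`Fil_v E[p^k] = Ψ(μ_{p^k})` has exactly `p^k` elements for every `k`, and `F⁺` is saturated:
`tateModuleFilAt_saturated`; cf. the tree's `natCard_torsionFilAt_pow_eq_…_three` at `p = 3`).
This is the «rank-one direct summand with unramified quotient» clause of `OrdinaryFiltration`. -/
theorem W1b_tateModuleFilAt_isCompl_of_multiplicative (W : WeierstrassCurve ℚ) [W.IsElliptic]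
    (p : ℕ) [Fact p.Prime] (v : HeightOneSpectrum (𝓞 ℚ)) (hv : ((p : ℕ) : 𝓞 ℚ) ∈ v.asIdeal)
    (hmult : W.HasMultiplicativeReductionAt v) :
    ∃ C : Submodule ℤ_[p] (W.tateModule p), IsCompl (tateModuleFilAt W p v) C ∧
      Module.finrank ℤ_[p] (tateModuleFilAt W p v) = 1 := by
  sorry

/-- **W1c (helper, S given W1 at level `k = 1`) — the RESIDUAL ordinary frame at a multiplicative
`v ∣ 5`.**  For any framing `ρ̄` of `E[5]` there is `Q ∈ GL₂(𝔽₅)` with `Q⁻¹ ρ̄|_{Γ_{ℚ_v}} Q` upper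
triangular, and on the inertia group with diagonal `(χ̄₅, 1)`.  This is exactly the input shape of
`NearlyOrdinaryDatum.frame_spec` (R side) and of `OrdinaryFiltration.exists_ofIntegralFrame`
(mod `5`), i.e. `ρ̄₀` is ORDINARY in Wiles' sense (Ch. 1, (1.2)) with `χ₂` unramified. -/
theorem W1c_residual_ordinary_frame (W : WeierstrassCurve ℚ) [W.IsElliptic]
    {ρ : ModPGaloisRep ℚ (ZMod 5) 2} (hρ : W.IsTorsionGaloisRep 5 ρ)
    (v : HeightOneSpectrum (𝓞 ℚ)) (hv : ((5 : ℕ) : 𝓞 ℚ) ∈ v.asIdeal)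
    (hmult : W.HasMultiplicativeReductionAt v) :
    ∃ Q : GL (Fin 2) (ZMod 5),
      (∀ σ : absoluteGaloisGroup (v.adicCompletion ℚ),
        (Q⁻¹ * ρ (absGaloisRestrict ℚ (v.adicCompletion ℚ) σ) * Q).val 1 0 = 0) ∧
      (∀ σ ∈ absInertia (v.adicCompletion ℚ),
        (Q⁻¹ * ρ (absGaloisRestrict ℚ (v.adicCompletion ℚ) σ) * Q).val 1 1 = 1 ∧
        (Q⁻¹ * ρ (absGaloisRestrict ℚ (v.adicCompletion ℚ) σ) * Q).val 0 0 =
          ((modPCyclotomicCharacterZMod ℚ 5 (absGaloisRestrict ℚ (v.adicCompletion ℚ) σ) :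
            (ZMod 5)ˣ) : ZMod 5)) := by
  sorry

/-- **W4a (helper, S−) — `χ̄₅` is totally ramified at `5`: it takes the value `2` (a generator of
`𝔽₅ˣ`) on the inertia group of `ℚ_v`, `v ∣ 5`.**  Twin of the tree's
`exists_mem_absInertia_modPCyclotomicCharacterZMod_three_eq_neg_one` (`3 ↦ 5`): from
`adicCompletion_rat_exists_mem_absInertia_cyclotomicCharacter_eq 5 v _ u` with `u ∈ ℤ₅ˣ`, `u ≡ 2`,
`cyclotomicCharacter_absGaloisRestrict` and `toZMod_cyclotomicCharacter_apply`.  With W1c it gives: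
`ρ̄₀` is `5`-DISTINGUISHED (`χ̄₁/χ̄₂ = χ̄₅ ≠ 1` on `D₅`, Wiles Ch. 2 §1; tree `IsPDistinguishedAt`)
and `ρ̄₀|_{D₅}` is not the exceptional `χ ⊕ χ`. [Serre, Local Fields IV §4 Prop. 17] -/
theorem W4a_exists_mem_absInertia_modPCyclotomicCharacterZMod_five_eq_two
    {v : HeightOneSpectrum (𝓞 ℚ)} (hv : ((5 : ℕ) : 𝓞 ℚ) ∈ v.asIdeal) :
    ∃ τ ∈ absInertia (v.adicCompletion ℚ),
      ((modPCyclotomicCharacterZMod ℚ 5 (absGaloisRestrict ℚ (v.adicCompletion ℚ) τ) :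
        (ZMod 5)ˣ) : ZMod 5) = 2 := by
  sorry

/-! ## §2 The Taylor–Wiles hypothesis at `p = 5` is already a THEOREM of the tree -/

/-- **W3 (PROVED by citation) — Kisin's hypothesis (3.2.3)(3) at `p = 5` for `ρ̄_{E,5}` of ANY
elliptic curve over `ℚ`, in any framing**: `Kisin2009.hypothesisFive_of_isTotallyReal` (ℚ is
totally real: Mathlib instance).  So the `p = 5` caveat of the Taylor–Wiles prime supply
([DDT 2.47]; Kisin (3.2.5)) costs nothing on this stub; k3's H5 (`SL₂(𝔽₅) = ρ̄(Γ_{ℚ(ζ_{5ⁿ})})`)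
is only needed if a prover wants the classical "`ρ̄|_{ℚ(ζ₅)}` absolutely irreducible" phrasing. -/
theorem W3_taylorWiles_hypothesis_five (W : WeierstrassCurve ℚ) [W.IsElliptic]
    {ρ : ModPGaloisRep ℚ (ZMod 5) 2} (hρ : W.IsTorsionGaloisRep 5 ρ) :
    Kisin2009.hypothesisFive ℚ ρ :=
  Kisin2009.hypothesisFive_of_isTotallyReal W hρ

end Summit.ABC.ABC.Cruxes.FreyModularity.StubIdeasLiftFive1g5

end
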